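import Summits.KontsevichZagierPeriods.KontsevichZagierPeriods.Theorems.LinRedNormalFormArrangementNormalFormStubRebaseOneMoves
import Summits.KontsevichZagierPeriods.KontsevichZagierPeriods.Theorems.LinRedNormalFormArrangementNormalFormStubRebaseOneJanus

/-!
# Stub `stub_rebaseOne` (crux `ArrangementNormalForm`, line `janus-bands`) — part `Above`

The case analysis of `stub_rebaseOne` (skeleton v4 of crux `ArrangementNormalForm`, line
`janus-bands`) for a lettered band `D = {y ∈ I, u(y) < t < v(y)}` lying ABOVE its letter `c`
(`c < u < v` on `I`), in sheared terms `ũ = u − c = K* + A (y − p)`, `ṽ = v − c = K* + B (y − p)`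
(apex `(p, K*)` if `A ≠ B`):
* a bound parallel to the letter (`A = 0` or `B = 0`): terminal move;
* THICK bands (`ṽ − ũ ≥ δ > 0`: parallel bounds, or apex below the letter `K* < 0`): Janus split at
  any rational level `K ≥ sup ṽ`;
* apex ON the letter line (`K* = 0`): blow-up to a rectangle;
* apex above the letter (`K* > 0`): Janus split AT THE APEX LEVEL `K*` — a genuine partition if
  `ũ < K* < ṽ`, an extension by the wedge `{ṽ < t' < K*}` (resp. `{K* < t' < ũ}`) otherwise; the
  wedge converges absolutely because its fibres are proportional to those of `D`.

References: M. Kontsevich, D. Zagier, *Periods* (2001), §1.2.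
-/

noncomputable section

open Set MeasureTheory
open Literature.NumberTheory.Transcendental
open Literature.ModelTheory.ExponentialFields

namespace Summit.KontsevichZagierPeriods.ArrangementNormalForm.JanusBands

namespace RebaseOne

/-- Goodness from a Janus extension `[T] = [D] + [W]`. -/
theorem good_of_janus {r rT rW : KZ.IntegralRep 2}
    (hrel : KZ.of rT - (KZ.of r + KZ.of rW) ∈ KZ.relations) (hT : Good (KZ.of rT))
    (hW : Good (KZ.of rW)) : Good (KZ.of r) := by
  refine good_of_sub_mem ?_ (hT.sub hW)
  have := KZ.relations.neg_mem hrel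
  rwa [show -(KZ.of rT - (KZ.of r + KZ.of rW)) = KZ.of r - (KZ.of rT - KZ.of rW) by abel] at this

/-- A band representation over an empty base is good. -/
theorem good_of_base_empty {r : KZ.IntegralRep 2} {m : ℕ} {M : Fin m → Aff} {U V : Aff}
    {T : IData} {a : Option Aff} (h : IsBandRep r M U V T a) (hI : baseSet M = ∅) :
    Good (KZ.of r) := by
  refine good_of_mem_relations (KZ.of_mem_relations_of_volume_eq_zero r ?_)
  rw [h.dom, show band (baseSet M) (ev U) (ev V) = ∅ by ext z; simp [band, hI], measure_empty]

/-- **Dissection into two sub-bands** (rule 1a). -/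
theorem good_split2 {r : KZ.IntegralRep 2} {m : ℕ} {M : Fin m → Aff} {U V : Aff} {T : IData}
    {a : Option Aff} (h : IsBandRep r M U V T a) {m' : ℕ} (M₁ M₂ : Fin m' → Aff)
    (U₁ V₁ U₂ V₂ : Aff) (h₁ : band (baseSet M₁) (ev U₁) (ev V₁) ⊆ r.domain)
    (h₂ : band (baseSet M₂) (ev U₂) (ev V₂) ⊆ r.domain)
    (hdisj : Disjoint (band (baseSet M₁) (ev U₁) (ev V₁)) (band (baseSet M₂) (ev U₂) (ev V₂)))
    {N : Set (Fin 2 → ℝ)} (hN : volume N = 0)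
    (hcov : ∀ z ∈ r.domain, z ∉ N →
      z ∈ band (baseSet M₁) (ev U₁) (ev V₁) ∨ z ∈ band (baseSet M₂) (ev U₂) (ev V₂))
    (hg₁ : ∀ r' : KZ.IntegralRep 2, IsBandRep r' M₁ U₁ V₁ T a → Good (KZ.of r'))
    (hg₂ : ∀ r' : KZ.IntegralRep 2, IsBandRep r' M₂ U₂ V₂ T a → Good (KZ.of r')) :
    Good (KZ.of r) := by
  refine good_of_pieces h (ι := Fin 2) ![M₁, M₂] ![U₁, U₂] ![V₁, V₂]
    (Fin.forall_fin_two.2 ⟨h₁, h₂⟩) (fun i j hij => ?_) hN (fun z hz hzN => ?_)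
    (Fin.forall_fin_two.2 ⟨hg₁, hg₂⟩)
  · fin_cases i <;> fin_cases j
    · exact absurd rfl hij
    · simpa using hdisj
    · simpa using hdisj.symm
    · exact absurd rfl hij
  · rcases hcov z hz hzN with hz' | hz'
    · exact ⟨0, hz'⟩
    · exact ⟨1, hz'⟩

/-- Sign transfer along the base: if `s w > 0` then `X w` has the sign of `X s`. -/
theorem sign_transfer (X : ℝ) {s w : ℝ} (hs : 0 < s * w) :
    (0 < X * s → 0 < X * w) ∧ (X * s < 0 → X * w < 0) := by
  have key : (X * w) * (s * w) = (X * s) * w ^ 2 := by ring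
  have hw : w ≠ 0 := by rintro rfl; simp at hs
  have hw2 : 0 < w ^ 2 := by positivity
  constructor
  · intro hX
    have h1 : 0 < (X * w) * (s * w) := by rw [key]; positivity
    by_contra hc
    push Not at hc
    nlinarith
  · intro hX
    have h1 : (X * w) * (s * w) < 0 := by rw [key]; exact mul_neg_of_neg_of_pos hX hw2
    by_contra hc
    push Not at hc
    nlinarith

/-- **A lettered band above its letter is good.** -/
theorem good_above {r : KZ.IntegralRep 2} {m : ℕ} {M : Fin m → Aff} {U V : Aff} {T : IData}
    {c : Aff} (h : IsBandRep r M U V T (some c))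
    (hI : ∀ y ∈ baseSet M, ev c y < ev U y ∧ ev U y < ev V y) : Good (KZ.of r) := by
  set A : ℚ := U.1 - c.1 with hA
  set B : ℚ := V.1 - c.1 with hB
  set a₀ : ℚ := U.2 - c.2 with ha₀
  set b₀ : ℚ := V.2 - c.2 with hb₀
  have hUc : ∀ y : ℝ, ev U y - ev c y = A * y + a₀ := fun y => by
    simp only [hA, ha₀, ev]; push_cast; ring
  have hVc : ∀ y : ℝ, ev V y - ev c y = B * y + b₀ := fun y => by
    simp only [hB, hb₀, ev]; push_cast; ring
  by_cases hA0 : A = 0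
  · exact good_lowerPar h (sub_eq_zero.1 hA0)
  by_cases hB0 : B = 0
  · exact good_upperPar h (sub_eq_zero.1 hB0)
  have hcK1 : ∀ K : ℚ, (c + (0, K)).1 = c.1 := fun K => by simp
  have hcKev : ∀ (K : ℚ) (y : ℝ), ev (c + (0, K)) y = ev c y + K := fun K y => by simp [ev_mk]
  have jup : ∀ (K : ℚ) (lam mlo : ℝ), 0 < lam → (∀ y ∈ baseSet M, ev U y < ev V y ∧
      ev V y ≤ ev c y + K ∧ 0 < mlo ∧ mlo ≤ ev V y - ev c y ∧
      ev c y + K - ev V y ≤ lam * (ev V y - ev U y)) → Good (KZ.of r) := by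
    intro K lam mlo hlam hyp
    obtain ⟨rT, rW, hT, hW, hrel⟩ := janus_up h K lam mlo hlam hyp
    exact good_of_janus hrel (good_upperPar hT (hcK1 K)) (good_upperPar hW (hcK1 K))
  have jdown : ∀ (K : ℚ) (lam : ℝ), 0 < lam → 0 < K → (∀ y ∈ baseSet M, ev U y < ev V y ∧
      ev c y + K ≤ ev U y ∧ ev U y - (ev c y + K) ≤ lam * (ev V y - ev U y)) → Good (KZ.of r) := by
    intro K lam hlam hK hyp
    obtain ⟨rT, rW, hT, hW, hrel⟩ := janus_down h K lam hlam hK hyp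
    exact good_of_janus hrel (good_lowerPar hT (hcK1 K)) (good_lowerPar hW (hcK1 K))
  -- a bound on the base and a rational level above `v - c`
  obtain ⟨Rb, hRb0, hRb⟩ := abs_base_le h fun y hy => (hI y hy).2
  obtain ⟨Kq, hKq⟩ := exists_rat_gt (|(B : ℝ)| * Rb + |(b₀ : ℝ)|)
  have hKq0 : (0 : ℝ) < Kq := lt_of_le_of_lt (by positivity) hKq
  have hVle : ∀ y ∈ baseSet M, |ev V y - ev c y| < Kq := fun y hy => by
    rw [hVc]
    calc |(B : ℝ) * y + b₀| ≤ |(B : ℝ) * y| + |(b₀ : ℝ)| := abs_add_le _ _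
      _ = |(B : ℝ)| * |y| + |(b₀ : ℝ)| := by rw [abs_mul]
      _ ≤ |(B : ℝ)| * Rb + |(b₀ : ℝ)| := by gcongr; exact hRb y hy
      _ < Kq := hKq
  -- THICK bands
  have thick : ∀ δ : ℝ, 0 < δ → (∀ y ∈ baseSet M, δ ≤ ev V y - ev U y) → Good (KZ.of r) := by
    intro δ hδ hthick
    refine jup Kq (2 * Kq / δ) δ (by positivity) fun y hy => ?_
    obtain ⟨hcU, hUV⟩ := hI y hy
    have hV := hVle y hy
    rw [abs_lt] at hV
    refine ⟨hUV, by linarith, hδ, by linarith [hthick y hy], ?_⟩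
    have : 2 * (Kq : ℝ) / δ * δ ≤ 2 * Kq / δ * (ev V y - ev U y) :=
      mul_le_mul_of_nonneg_left (hthick y hy) (by positivity)
    rw [div_mul_cancel₀ _ hδ.ne'] at this
    linarith
  by_cases hAB : A = B
  · rcases (baseSet M).eq_empty_or_nonempty with hemp | ⟨y₀, hy₀⟩
    · exact good_of_base_empty h hemp
    refine thick (ev V y₀ - ev U y₀) (by linarith [(hI y₀ hy₀).2]) fun y _ => le_of_eq ?_
    have e1 := hUc y
    have e2 := hVc y
    have e3 := hUc y₀
    have e4 := hVc y₀
    rw [hAB] at e1 e3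
    linarith
  -- the apex `(p, K*)`
  set p : ℚ := (a₀ - b₀) / (B - A) with hp
  set Ks : ℚ := A * p + a₀ with hKs
  have hBA : B - A ≠ 0 := sub_ne_zero.2 (Ne.symm hAB)
  have hpq : (B - A) * p = a₀ - b₀ := by rw [hp]; field_simp
  have hUK : ∀ y : ℝ, ev U y - ev c y = Ks + A * (y - p) := fun y => by
    rw [hUc, hKs]; push_cast; ring
  have hVK : ∀ y : ℝ, ev V y - ev c y = Ks + B * (y - p) := fun y => by
    have hpr : ((B : ℝ) - A) * p = a₀ - b₀ := by exact_mod_cast hpq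
    rw [hVc, hKs]; push_cast; linear_combination hpr
  have hVU : ∀ y : ℝ, ev V y - ev U y = ((B : ℝ) - A) * (y - p) := fun y => by
    have e1 := hUK y; have e2 := hVK y
    have : ((B : ℝ) - A) * (y - p) = (Ks + B * (y - p)) - (Ks + A * (y - p)) := by ring
    linarith
  have hw : ∀ y ∈ baseSet M, 0 < ((B : ℝ) - A) * (y - p) := fun y hy => by
    rw [← hVU]; linarith [(hI y hy).2]
  have hA' : (A : ℝ) ≠ 0 := by exact_mod_cast hA0
  have hBA' : (B : ℝ) - A ≠ 0 := by exact_mod_cast hBA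
  rcases lt_trichotomy Ks 0 with hKneg | hK0 | hKpos
  · -- apex below the letter: thick
    have hKn : (0 : ℝ) < -(Ks : ℝ) := by exact_mod_cast neg_pos.2 hKneg
    refine thick (|(B : ℝ) - A| * (-(Ks : ℝ) / |(A : ℝ)|)) (by positivity) fun y hy => ?_
    obtain ⟨hcU, hUV⟩ := hI y hy
    have hu : 0 < (Ks : ℝ) + A * (y - p) := by rw [← hUK]; linarith
    have hAp : (0 : ℝ) < |(A : ℝ)| := abs_pos.2 hA'
    have h1 : -(Ks : ℝ) < |(A : ℝ)| * |y - p| := by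
      rw [← abs_mul]; exact lt_of_lt_of_le (by linarith) (le_abs_self _)
    have h2 : -(Ks : ℝ) / |(A : ℝ)| < |y - p| := by rwa [div_lt_iff₀ hAp, mul_comm]
    rw [hVU, show ((B : ℝ) - A) * (y - p) = |(B : ℝ) - A| * |y - p| by
      rw [← abs_mul]; exact (abs_of_pos (hw y hy)).symm]
    exact mul_le_mul_of_nonneg_left h2.le (abs_nonneg _)
  · -- apex on the letter line: blow up
    set ε : ℚ := if 0 < B - A then 1 else -1 with hε
    have hε1 : ε = 1 ∨ ε = -1 := by rw [hε]; split_ifs <;> simp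
    have hεw : ∀ y ∈ baseSet M, 0 < (ε : ℝ) * (y - p) := fun y hy => by
      have hst := sign_transfer 1 (hw y hy)
      rw [hε]
      split_ifs with hs
      · have hs' : (0 : ℝ) < 1 * (B - A) := by rw [one_mul]; exact_mod_cast hs
        simpa using hst.1 hs'
      · have hs' : (1 : ℝ) * (B - A) < 0 := by
          rw [one_mul]; exact_mod_cast lt_of_le_of_ne (not_lt.1 hs) hBA
        have := hst.2 hs'
        push_cast; linarith
    obtain ⟨r', h', hrel⟩ := band_blow h p A B ε hε1 (fun y hy => ⟨hεw y hy, (hI y hy).2⟩)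
      (fun y => by have := hUK y; rw [hK0] at this; push_cast at this; linarith)
      (fun y => by have := hVK y; rw [hK0] at this; push_cast at this; linarith)
    refine good_of_sub_mem hrel (good_of_mem (mem_GGlit h' (fun c' hc' => ?_) (Or.inl rfl) (Or.inl rfl)))
    cases hc'
    rfl
  · -- apex above the letter: Janus split at the apex level
    have hKs' : (0 : ℝ) < Ks := by exact_mod_cast hKpos
    rcases lt_or_gt_of_ne (mul_ne_zero hA0 hBA : A * (B - A) ≠ 0) with hAs | hAs
    · have hAw : ∀ y ∈ baseSet M, (A : ℝ) * (y - p) < 0 := fun y hy =>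
        (sign_transfer (A : ℝ) (hw y hy)).2 (by exact_mod_cast hAs)
      rcases lt_or_gt_of_ne (mul_ne_zero hB0 hBA : B * (B - A) ≠ 0) with hBs | hBs
      · -- nested above: extend by the wedge `{v < t < c + K*}`
        have hBw : ∀ y ∈ baseSet M, (B : ℝ) * (y - p) < 0 := fun y hy =>
          (sign_transfer (B : ℝ) (hw y hy)).2 (by exact_mod_cast hBs)
        set q : ℝ := (B : ℝ) / A with hq
        refine jup Ks (-(B : ℝ) / (B - A)) ((Ks : ℝ) * (1 - q)) ?_ fun y hy => ?_
        · have : -(B : ℝ) / (B - A) = -((B : ℝ) * (B - A)) / (B - A) ^ 2 := by field_simp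
          rw [this]
          exact div_pos (by exact_mod_cast neg_pos.2 hBs) (by positivity)
        · obtain ⟨hcU, hUV⟩ := hI y hy
          have eU := hUK y
          have eV := hVK y
          have hBy := hBw y hy
          have hAy := hAw y hy
          have hAB2 : (A : ℝ) * (y - p) < B * (y - p) := by linarith
          have hu : 0 < (Ks : ℝ) + A * (y - p) := by linarith
          have hqw : q * ((A : ℝ) * (y - p)) = B * (y - p) := by rw [hq]; field_simp
          have hq0 : 0 < q := by nlinarith
          have hq1 : q < 1 := by nlinarith
          refine ⟨hUV, by linarith, mul_pos hKs' (by linarith), ?_, ?_⟩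
          · have : (Ks : ℝ) + B * (y - p) - Ks * (1 - q) = q * (Ks + A * (y - p)) := by
              linear_combination (-1 : ℝ) * hqw
            nlinarith [mul_pos hq0 hu]
          · rw [hVU]
            have : -(B : ℝ) / (B - A) * ((B - A) * (y - p)) = -(B * (y - p)) := by field_simp
            rw [this]
            linarith
      · -- partition at the apex level
        have hBw : ∀ y ∈ baseSet M, 0 < (B : ℝ) * (y - p) := fun y hy =>
          (sign_transfer (B : ℝ) (hw y hy)).1 (by exact_mod_cast hBs)
        have key : ∀ y ∈ baseSet M, ev U y < ev (c + (0, Ks)) y ∧ ev (c + (0, Ks)) y < ev V y :=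
          fun y hy => by
            rw [hcKev]
            constructor <;> linarith [hUK y, hVK y, hAw y hy, hBw y hy]
        refine good_split2 h M M U (c + (0, Ks)) (c + (0, Ks)) V ?_ ?_ ?_
          (volume_graph_ev (c + (0, Ks))) ?_ (fun r' hr' => good_upperPar hr' (hcK1 Ks))
          (fun r' hr' => good_lowerPar hr' (hcK1 Ks))
        · rw [h.dom]
          rintro z ⟨hy, h1, h2⟩
          exact ⟨hy, h1, by linarith [(key _ hy).2]⟩
        · rw [h.dom]
          rintro z ⟨hy, h1, h2⟩
          exact ⟨hy, by linarith [(key _ hy).1], h2⟩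
        · exact Set.disjoint_left.2 fun z hz hz' => by linarith [hz.2.2, hz'.2.1]
        · intro z hz hzN
          rw [h.dom] at hz
          obtain ⟨hy, h1, h2⟩ := hz
          rcases lt_trichotomy (z 1) (ev (c + (0, Ks)) (z 0)) with ht | ht | ht
          · exact Or.inl ⟨hy, h1, ht⟩
          · exact absurd ht hzN
          · exact Or.inr ⟨hy, ht, h2⟩
    · -- nested below: extend by the wedge `{c + K* < t < u}`
      have hAw : ∀ y ∈ baseSet M, 0 < (A : ℝ) * (y - p) := fun y hy =>
        (sign_transfer (A : ℝ) (hw y hy)).1 (by exact_mod_cast hAs)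
      refine jdown Ks ((A : ℝ) / (B - A)) ?_ hKpos fun y hy => ?_
      · have : (A : ℝ) / (B - A) = ((A : ℝ) * (B - A)) / (B - A) ^ 2 := by field_simp
        rw [this]
        exact div_pos (by exact_mod_cast hAs) (by positivity)
      · obtain ⟨hcU, hUV⟩ := hI y hy
        refine ⟨hUV, by linarith [hUK y, hAw y hy], ?_⟩
        rw [hVU]
        have : (A : ℝ) / (B - A) * ((B - A) * (y - p)) = A * (y - p) := by field_simp
        rw [this]
        linarith [hUK y]

end RebaseOne

/-- Registered support goal of this file: sign transfer along the base. -/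
theorem rebaseOne_sign_transfer (X s w : ℝ) (hs : 0 < s * w) : (0 < X * s → 0 < X * w) ∧ (X * s < 0 → X * w < 0) :=
  RebaseOne.sign_transfer X hs

end Summit.KontsevichZagierPeriods.ArrangementNormalForm.JanusBands
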